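import Summits.QuantumFields.YangMills.Theorems.UnitScaleTiltFluctuationComparisonRegPrGlobalSlackLocalToGlobal
import HarnessLib

/-!
# `…GlobalSlackLocalToGlobalCount` — LOCAL ⇒ GLOBAL WITH KING'S SLACK OVER A LEVEL-COUNT ROW: the `L ≤ M₁` letter of lane A's capstone is an artefact of the
# volume NORMALISATION, not content (crux `FluctuationComparisonRegPrIntL`, stmt-QuantumFields-20520 — formerly 19935 —, STUB 3⁗ `stub_globalTwoRunSlackFam`;
# width-lever lane A «order-σ matched height-free kernels», OWNER ym3-torus-plan g22 RULING №5 §C ask W-slack-1)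

Seat ym-ust-19935-slack g2 (prover).  WHY.  The producer `GlobalSlackLocalToGlobal.globalTwoRunSlackTail_of_polymerSlack` (p530498, port of ideator-1 g11) reads the
two geometric rows `LocCover D κ₁ C′` ((45)) and `LocBlockVolume D` ((24): a term-level-`i` localisation domain has `≥ L^{3i}` fine sites) ONLY through the level count
`PolymerBudget.sum_exp_le`: `Σ_{Y ∈ Loc K j h i} e^{−κ₁𝓛(Y)} ≤ max(C′,0)·8·L^{3(m_F+K)}/L^{3i}` (= `max(C′,0)` times the number of level-`i` blocks).  For the canonical
polymerisation of a v3 family (`GlobalSlackCanonicalPolymers.canonPolymer`, p533541) a step-`(i−1)` retained domain has `#X.1·min(M₁, S_{i−1})³·L^{3(i−1)}` fine sites,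
so `LocBlockVolume` holds only under the letter `L ≤ 𝔠.M₁` (`…CanonicalPolymersVolume.locBlockVolume_canon`, p534516) — print has «M₁ sufficiently large» (p.262),
the constants record `AlphaConsts` only `0 < M₁`.  This file re-runs the producer over the COUNT itself, so that a volume row with ANY positive constant `c`
(`LocBlockVolumeC D c`: `c·L^{3i} ≤ #Y`; `c = min 1 (M₁/L)³` for `canonPolymer`, NO letter — sibling file `…CanonicalPolymersVolumeC`) feeds it at the price
`C′ ↦ max(C′,0)/c` in the `K`-UNIFORM constant, which 3⁗'s `∃ C` (bound after `L, 𝔠`) absorbs.  So no record row `L ≤ M₁` is needed for 3⁗ (answer to W-slack-1).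

CONTENT.  §1 rows `LocCount D κ₁ C′` (the level count, `0 ≤ C′`) and `LocBlockVolumeC D c`; `locCount_of_cover_of_volume` (`LocCover ∧ LocBlockVolume ⟹ LocCount (max C′ 0)`),
`locCount_of_cover_of_volumeC` (`LocCover ∧ LocBlockVolumeC c ⟹ LocCount (max C′ 0 / c)`), `locBlockVolumeC_one_of_volume`.  §2 the two budgets over the count
(`extra_budget_le_count`, `level_budget_geom_le_count` — the proofs of `PolymerBudget.extra_budget_le` / `GlobalSlackLocalToGlobal.level_budget_geom_le` with the count as
hypothesis).  §3 **`globalSupRateWSlack_of_polymerWSlack_count`**, **`globalSupRateTSlack_of_polymerSlack_count`**, **`globalTwoRunSlackTail_of_polymerSlack_count`** — p530498's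
three producer theorems VERBATIM with `(hLC : LocCover D κ₁ C′) (hBV : LocBlockVolume D)` replaced by `(hCnt : LocCount D κ₁ C′)` (constant `C′·(C_T + C/(1 − L^{a−1}) +
C/(1 − L⁻¹))`), and the `…_volC` corollaries over `LocCover ∧ LocBlockVolumeC`.  CREDIT: the counting is ym-cruxidea-19201-1 g11's (port ym3-torus-p2 g14); this seat only
re-threaded the hypothesis.  Nothing of [Balaban1985UV3]/[King1986] is asserted: rows are hypothesis schemas, theorems are counting.

References: C. King, CMP 102 (1986) 649–677 [King1986] (Thm 3.4 (3.9) p.656, (3.12)–(3.13) p.657); T. Bałaban, CMP 102 (1985) 255–275 [Balaban1985UV3] ((24) p.262,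
(43)–(46) pp.266–267).
-/

set_option autoImplicit false

noncomputable section

open scoped BigOperators
open Literature.MathematicalPhysics.QuantumFieldTheory.Balaban1983to89
open Literature.MathematicalPhysics.QuantumFieldTheory.Balaban1983to89.T3ContinuumYM3Torus
open Literature.MathematicalPhysics.QuantumFieldTheory.Balaban1983to89.T3UnitScaleTilt
open Literature.MathematicalPhysics.QuantumFieldTheory.Balaban1983to89.T3LevelShift
open Literature.MathematicalPhysics.QuantumFieldTheory.Balaban1983to89.T3AlphaInputsAC
open Literature.MathematicalPhysics.QuantumFieldTheory.Balaban1983to89.T3AlphaPolymerSocket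
open Literature.MathematicalPhysics.QuantumFieldTheory.Balaban1983to89.T3AlphaInputsACTwoRun
open Literature.MathematicalPhysics.QuantumFieldTheory.Balaban1983to89.T3AlphaInputsACTwoRunLevel
open Literature.MathematicalPhysics.QuantumFieldTheory.Balaban1983to89.T3Thresholds
open Summit.QuantumFields.YangMills.Theorems.LogComparisonSocketLevelsAlpha (sum_loc_exp_le_of_locCover_of_volume)
open Summit.QuantumFields.YangMills.Theorems.LogComparisonPolymerBudget
  (card_site_zero sum_exp_le inv_pow_pow_eq_rpow inv_pow_rpow_eq_rpow)
open Summit.QuantumFields.YangMills.Theorems.LogComparisonLevelCauchyMinT (levelDataT PintH_eq_sum_levelDataT)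
open Summit.QuantumFields.YangMills.Theorems.GlobalSlack (GlobalSupRateTSlack)
open Summit.QuantumFields.YangMills.Theorems.GlobalSlackLocalToGlobal

namespace Summit.QuantumFields.YangMills.Theorems.GlobalSlackLocalToGlobalCount

variable {F : T3Family} {γ : ℝ}

/-! ## §1 The level-count row and the `c`-weighted block-volume row -/

section Defs

variable (D : AlphaDataT3 F γ)

/-- **THE LEVEL COUNT** (hypothesis schema, never asserted): `0 ≤ C′` and for every run `K`, level `j`, history `h` and term level `i`,
`Σ_{Y ∈ Loc K j h i} e^{−κ₁𝓛(Y)} ≤ C′·8·L^{3(m_F+K)}/L^{3i}` — (45)–(46) p.267 summed over the level-`i` blocks (`8·L^{3(m_F+K)}/L^{3i}` of them): the ONLY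
form in which the producer reads `LocCover`/`LocBlockVolume` (`PolymerBudget.sum_exp_le`). [cite: Balaban1985UV3, (45)-(46) p.267] -/
def LocCount (κ₁ C' : ℝ) : Prop :=
  0 ≤ C' ∧ ∀ (K j : ℕ) (h : D.Hist K j) (i : ℕ),
    ∑ Y ∈ D.Loc K j h i, Real.exp (-κ₁ * D.treeLen K i Y) ≤ C' * 8 * (F.L : ℝ) ^ (3 * (F.m + K)) / (F.L : ℝ) ^ (3 * i)

/-- **THE `c`-WEIGHTED BLOCK VOLUME** (hypothesis schema, never asserted): `0 < c` and every listed term-level-`i` localisation domain of run `K` contains at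
least `c·L^{3i}` fine sites — (24) p.262 «connected unions of big blocks» of side `M₁L^{i−1}`, i.e. `c = (M₁/L)³ ∧ 1` with NO condition on `M₁`
(`LocBlockVolume` is `c = 1`). [cite: Balaban1985UV3, (24) p.262] -/
def LocBlockVolumeC (c : ℝ) : Prop :=
  0 < c ∧ ∀ (K j : ℕ) (h : D.Hist K j) (i : ℕ), ∀ Y ∈ D.Loc K j h i,
    c * (F.L : ℝ) ^ (3 * i) ≤ ∑ y : Site (F.P K) 0, Y.indicator (fun _ => (1 : ℝ)) y

end Defs

/-- `LocBlockVolume` is the `c = 1` weighted volume row. [cite: Balaban1985UV3, (24) p.262] -/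
theorem locBlockVolumeC_one_of_volume {D : AlphaDataT3 F γ} (hBV : LocBlockVolume D) : LocBlockVolumeC D 1 :=
  ⟨one_pos, fun K j h i Y hY => by rw [one_mul]; exact hBV K j h i Y hY⟩

/-- A smaller positive weight is a weaker volume row. [cite: Balaban1985UV3, (24) p.262] -/
theorem locBlockVolumeC_mono {D : AlphaDataT3 F γ} {c c' : ℝ} (hc' : 0 < c') (hle : c' ≤ c) (h : LocBlockVolumeC D c) : LocBlockVolumeC D c' :=
  ⟨hc', fun K j hh i Y hY => (mul_le_mul_of_nonneg_right hle (by positivity)).trans (h.2 K j hh i Y hY)⟩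

/-- **THE COUNT FROM `LocCover` AND `LocBlockVolume`** (= `PolymerBudget.sum_exp_le`): constant `max(C′,0)`. [cite: Balaban1985UV3, (45)-(46) p.267] -/
theorem locCount_of_cover_of_volume {D : AlphaDataT3 F γ} {κ₁ C' : ℝ} (hLC : LocCover D κ₁ C') (hBV : LocBlockVolume D) :
    LocCount D κ₁ (max C' 0) :=
  ⟨le_max_right _ _, fun K j h i => sum_exp_le D hLC hBV K j h i⟩

/-- **THE COUNT FROM `LocCover` AND THE `c`-WEIGHTED VOLUME**: constant `max(C′,0)/c` — the whole price of a small `M₁`. [cite: Balaban1985UV3, (45)-(46) p.267] -/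
theorem locCount_of_cover_of_volumeC {D : AlphaDataT3 F γ} {κ₁ C' c : ℝ} (hLC : LocCover D κ₁ C') (hBV : LocBlockVolumeC D c) :
    LocCount D κ₁ (max C' 0 / c) := by
  obtain ⟨hc, hvol⟩ := hBV
  refine ⟨div_nonneg (le_max_right _ _) hc.le, fun K j h i => ?_⟩
  have hL0 : (0 : ℝ) < (F.L : ℝ) := by have := F.hL.2; exact_mod_cast (by omega : 0 < F.L)
  have hN : (0 : ℝ) < c * (F.L : ℝ) ^ (3 * i) := mul_pos hc (pow_pos hL0 _)
  have h1 := sum_loc_exp_le_of_locCover_of_volume D hLC K j h i hN (hvol K j h i)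
  rw [card_site_zero] at h1
  refine h1.trans ?_
  have hpow : (0 : ℝ) < (F.L : ℝ) ^ (3 * i) := pow_pos hL0 _
  have heq : C' * (8 * (F.L : ℝ) ^ (3 * (F.m + K))) / (c * (F.L : ℝ) ^ (3 * i)) =
      C' / c * (8 * (F.L : ℝ) ^ (3 * (F.m + K))) / (F.L : ℝ) ^ (3 * i) := by
    rw [div_eq_mul_inv, div_eq_mul_inv, div_eq_mul_inv, mul_inv]
    ring
  rw [heq, show max C' 0 / c * 8 * (F.L : ℝ) ^ (3 * (F.m + K)) = max C' 0 / c * (8 * (F.L : ℝ) ^ (3 * (F.m + K))) by ring]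
  exact div_le_div_of_nonneg_right
    (mul_le_mul_of_nonneg_right (div_le_div_of_nonneg_right (le_max_left _ _) hc.le) (by positivity)) hpow.le

/-! ## §2 The two budgets over the count -/

/-- **THE EXTRA FINEST SLICE OVER THE COUNT** (`PolymerBudget.extra_budget_le` with the count as hypothesis): for `n ≤ K`, `0 ≤ C`, `b ≤ 1`,
`Σ_{Y ∈ Loc (K+1) (K+1−n) h 1} C·e^{−κ₁𝓛(Y)}·Θ²·((L^{K−n})⁻¹)^4 ≤ 8C·C′·Θ²·L^{3m_F}·L^{3n − b(K−n)}`. [cite: Balaban1985UV3, (44)-(46) p.267] -/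
theorem extra_budget_le_count {D : AlphaDataT3 F γ} {κ₁ C' : ℝ} (hCnt : LocCount D κ₁ C') {C Θ b : ℝ} (hC : 0 ≤ C) (hb1 : b ≤ 1)
    {K n : ℕ} (hn : n ≤ K) (h : D.Hist (K + 1) (K + 1 - n)) :
    ∑ Y ∈ D.Loc (K + 1) (K + 1 - n) h 1, C * Real.exp (-κ₁ * D.treeLen (K + 1) 1 Y) * Θ ^ 2 * (((F.L : ℝ) ^ (K - n))⁻¹) ^ 4 ≤
      8 * C * C' * Θ ^ 2 * (F.L : ℝ) ^ (3 * F.m) * (F.L : ℝ) ^ ((3 * n - b * (K - n : ℕ) : ℝ)) := by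
  have hC'0 : 0 ≤ C' := hCnt.1
  have hL : (1 : ℝ) < (F.L : ℝ) := by exact_mod_cast F.hL.2
  have hL0 : (0 : ℝ) < (F.L : ℝ) := by linarith
  have hfac : ∀ Y, C * Real.exp (-κ₁ * D.treeLen (K + 1) 1 Y) * Θ ^ 2 * (((F.L : ℝ) ^ (K - n))⁻¹) ^ 4 =
      (C * Θ ^ 2 * (((F.L : ℝ) ^ (K - n))⁻¹) ^ 4) * Real.exp (-κ₁ * D.treeLen (K + 1) 1 Y) := fun Y => by ring
  simp_rw [hfac]
  rw [← Finset.mul_sum]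
  have hcoef : 0 ≤ C * Θ ^ 2 * (((F.L : ℝ) ^ (K - n))⁻¹) ^ 4 := by positivity
  refine (mul_le_mul_of_nonneg_left (hCnt.2 (K + 1) (K + 1 - n) h 1) hcoef).trans ?_
  -- the exponent: 3(m_F + K + 1) − 4(K−n) − 3 ≤ 3m_F + 3n − b(K−n)
  have hlev : (F.L : ℝ) ^ (3 * (F.m + (K + 1))) * (((F.L : ℝ) ^ (K - n))⁻¹) ^ 4 / (F.L : ℝ) ^ (3 * 1) ≤
      (F.L : ℝ) ^ (3 * F.m) * (F.L : ℝ) ^ ((3 * n - b * (K - n : ℕ) : ℝ)) := by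
    rw [inv_pow_pow_eq_rpow hL0, ← Real.rpow_natCast (F.L : ℝ) (3 * (F.m + (K + 1))), ← Real.rpow_natCast (F.L : ℝ) (3 * 1),
      ← Real.rpow_natCast (F.L : ℝ) (3 * F.m), div_eq_mul_inv, ← Real.rpow_neg hL0.le, ← Real.rpow_add hL0, ← Real.rpow_add hL0,
      ← Real.rpow_add hL0]
    refine Real.rpow_le_rpow_of_exponent_le hL.le ?_
    have hKn : ((K - n : ℕ) : ℝ) = (K : ℝ) - n := by rw [Nat.cast_sub hn]
    have hn' : (n : ℝ) ≤ K := by exact_mod_cast hn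
    have hslack : 0 ≤ (1 - b) * ((K : ℝ) - n) := mul_nonneg (by linarith) (by linarith)
    push_cast
    rw [hKn]
    nlinarith
  calc C * Θ ^ 2 * (((F.L : ℝ) ^ (K - n))⁻¹) ^ 4 * (C' * 8 * (F.L : ℝ) ^ (3 * (F.m + (K + 1))) / (F.L : ℝ) ^ (3 * 1))
      = 8 * C * C' * Θ ^ 2 * ((F.L : ℝ) ^ (3 * (F.m + (K + 1))) * (((F.L : ℝ) ^ (K - n))⁻¹) ^ 4 / (F.L : ℝ) ^ (3 * 1)) := by
        ring
    _ ≤ 8 * C * C' * Θ ^ 2 * ((F.L : ℝ) ^ (3 * F.m) * (F.L : ℝ) ^ ((3 * n - b * (K - n : ℕ) : ℝ))) :=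
        mul_le_mul_of_nonneg_left hlev (by positivity)
    _ = _ := by ring

/-- **ONE LEVEL, MARGIN KEPT, OVER THE COUNT** (`GlobalSlackLocalToGlobal.level_budget_geom_le` with the count as hypothesis): for `n ≤ K`, `j < K − n`, `0 ≤ M₀` and
any real `b`, `Σ_{Y ∈ Loc K (K−n) h (1+j)} M₀·e^{−κ₁𝓛(Y)}·((L^{K−n−1−j})⁻¹)^4·((L^{1+j})⁻¹)^b ≤ 8M₀·C′·L^{3m_F}·L^{3n − b(K−n)}·(L^{b−1})^{K−n−1−j}`.
[cite: Balaban1985UV3, (45)-(46) p.267; King1986, (3.12)-(3.13) p.657] -/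
theorem level_budget_geom_le_count {D : AlphaDataT3 F γ} {κ₁ C' : ℝ} (hCnt : LocCount D κ₁ C') {M₀ : ℝ} (hM : 0 ≤ M₀)
    (b : ℝ) {K n : ℕ} (hn : n ≤ K) (h : D.Hist K (K - n)) {j : ℕ} (hj : j < K - n) :
    ∑ Y ∈ D.Loc K (K - n) h (1 + j), M₀ * Real.exp (-κ₁ * D.treeLen K (1 + j) Y) * (((F.L : ℝ) ^ (K - n - 1 - j))⁻¹) ^ 4 *
        (((F.L : ℝ) ^ (1 + j))⁻¹) ^ b ≤
      8 * M₀ * C' * (F.L : ℝ) ^ (3 * F.m) * (F.L : ℝ) ^ ((3 * n - b * (K - n : ℕ) : ℝ)) *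
        ((F.L : ℝ) ^ (b - 1)) ^ (K - n - 1 - j) := by
  have hC : 0 ≤ C' := hCnt.1
  have hL : (1 : ℝ) < (F.L : ℝ) := by exact_mod_cast F.hL.2
  have hL0 : (0 : ℝ) < (F.L : ℝ) := by linarith
  have hki : K - n - 1 - j = (K - n) - (1 + j) := by omega
  have hfac : ∀ Y, M₀ * Real.exp (-κ₁ * D.treeLen K (1 + j) Y) * (((F.L : ℝ) ^ (K - n - 1 - j))⁻¹) ^ 4 * (((F.L : ℝ) ^ (1 + j))⁻¹) ^ b =
      (M₀ * (((F.L : ℝ) ^ (K - n - 1 - j))⁻¹) ^ 4 * (((F.L : ℝ) ^ (1 + j))⁻¹) ^ b) * Real.exp (-κ₁ * D.treeLen K (1 + j) Y) :=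
    fun Y => by ring
  simp_rw [hfac]
  rw [← Finset.mul_sum]
  have hcoef : 0 ≤ M₀ * (((F.L : ℝ) ^ (K - n - 1 - j))⁻¹) ^ 4 * (((F.L : ℝ) ^ (1 + j))⁻¹) ^ b := by positivity
  refine (mul_le_mul_of_nonneg_left (hCnt.2 K (K - n) h (1 + j)) hcoef).trans ?_
  have hlev := level_factor_geom_le hL F.m (K := K) (n := n) (k := K - n) (i := 1 + j) (by omega) (by omega) b
  rw [hki]
  calc M₀ * (((F.L : ℝ) ^ (K - n - (1 + j)))⁻¹) ^ 4 * (((F.L : ℝ) ^ (1 + j))⁻¹) ^ b *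
        (C' * 8 * (F.L : ℝ) ^ (3 * (F.m + K)) / (F.L : ℝ) ^ (3 * (1 + j)))
      = 8 * M₀ * C' * ((F.L : ℝ) ^ (3 * (F.m + K)) * (((F.L : ℝ) ^ (K - n - (1 + j)))⁻¹) ^ 4 *
          (((F.L : ℝ) ^ (1 + j))⁻¹) ^ b / (F.L : ℝ) ^ (3 * (1 + j))) := by ring
    _ ≤ 8 * M₀ * C' * ((F.L : ℝ) ^ (3 * F.m) * (F.L : ℝ) ^ ((3 * n - b * (K - n : ℕ) : ℝ)) *
          ((F.L : ℝ) ^ (b - 1)) ^ (K - n - (1 + j))) :=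
        mul_le_mul_of_nonneg_left hlev (by positivity)
    _ = _ := by ring

/-! ## §3 LOCAL ⇒ GLOBAL WITH THE SLACK, OVER THE COUNT -/

/-- **THE GLOBAL SLACK ROW FROM THE PER-POLYMER SLACK ROW OVER THE LEVEL COUNT, GENERIC RATE WEIGHT** (PROVED; = p530498's
`globalSupRateWSlack_of_polymerWSlack` with `LocCover ∧ LocBlockVolume` replaced by `LocCount`): for `0 < γ ≤ 1`, `0 < b₀`, a weight `w n ≥ 0` dominating
`θ(n+1)²`, `0 < a < 1`, `0 ≤ C`, `0 ≤ C_T`: the (43)-decomposition over a term function, the level count and matched localisation domains at the row's decay rate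
`κ₁`, the printed size (44) of the terms and the per-polymer two-cut-off row with King's slack give the GLOBAL row with slack at the same `w`, `a`, `σ` and the
`K`-UNIFORM constant `C′·(C_T + C/(1 − L^{a−1}) + C/(1 − L⁻¹))`. [cite: King1986, Thm 3.4 (3.9) p.656 and (3.12)-(3.13) p.657; Balaban1985UV3, (43)-(46) pp.266-267] -/
theorem globalSupRateWSlack_of_polymerWSlack_count {D : AlphaDataT3 F γ} {PT : TermFn F} {b₀ p₀ κ₁ a C C_T C' : ℝ} {σ : ℕ} {w : ℕ → ℝ}
    (hγ : 0 < γ) (hγ1 : γ ≤ 1) (hb : 0 < b₀) (hw0 : ∀ n, 0 ≤ w n) (hw : ∀ n, θBal F.L γ b₀ p₀ (n + 1) ^ 2 ≤ w n)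
    (ha : 0 < a) (ha1 : a < 1) (hC : 0 ≤ C) (hCT : 0 ≤ C_T)
    (hdec : PintDecompTrivT D PT) (hCnt : LocCount D κ₁ C') (hLM : LocMatched D)
    (hTS : TermSizeTrivT D PT b₀ p₀ C_T κ₁) (hPC : PolymerCauchyMinAtWSlack D PT b₀ p₀ κ₁ w a σ C) :
    GlobalSupRateWSlack D b₀ p₀ w a σ (C' * (C_T + C / (1 - (F.L : ℝ) ^ (a - 1)) + C / (1 - (F.L : ℝ)⁻¹))) := by
  classical
  obtain ⟨c, hc⟩ := hPC
  obtain ⟨_, hts⟩ := hTS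
  have hC' : 0 ≤ C' := hCnt.1
  have hLn : 1 ≤ F.L := F.hL.2.le
  have hL : (1 : ℝ) < (F.L : ℝ) := by exact_mod_cast F.hL.2
  have hL0 : (0 : ℝ) < (F.L : ℝ) := by linarith
  -- the two geometric ratios
  set ra : ℝ := (F.L : ℝ) ^ (a - 1) with hra_def
  set r0 : ℝ := (F.L : ℝ)⁻¹ with hr0_def
  have hra0 : 0 ≤ ra := (Real.rpow_pos_of_pos hL0 _).le
  have hra1 : ra < 1 := Real.rpow_lt_one_of_one_lt_of_neg hL (by linarith)
  have hr00 : 0 ≤ r0 := (inv_pos.mpr hL0).le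
  have hr01 : r0 < 1 := inv_lt_one_of_one_lt₀ hL
  have hθ : ∀ i, 0 ≤ θBal F.L γ b₀ p₀ i := fun i => (T3MinimiserStabilityReduction.θBal_pos hLn hγ hγ1 hb p₀ i).le
  have hTa : 0 ≤ C / (1 - ra) := div_nonneg hC (by linarith)
  have hT0 : 0 ≤ C / (1 - r0) := div_nonneg hC (by linarith)
  refine ⟨fun K n => ∑ j ∈ Finset.range (K - n), ∑ Y ∈ D.Loc K (K - n) (D.triv K (K - n)) (1 + j), c K n j Y, ?_⟩
  intro K n hn V hV
  have hle : n ≤ K + 1 := hn.trans (Nat.le_succ K)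
  set θ := θBal F.L γ b₀ p₀ n with hθ_def
  set N : ℝ := (Fintype.card (Site (F.P n) 0) : ℝ) with hN_def
  have hN0 : 0 ≤ N := by positivity
  set La : ℝ := (((F.L : ℝ) ^ (K - n))⁻¹) ^ a with hLa_def
  have hLa0 : 0 ≤ La := by positivity
  have hθn : 0 ≤ θ := hθ n
  have hθσ : 0 ≤ θ ^ σ := pow_nonneg hθn σ
  have hwn : 0 ≤ w n := hw0 n
  -- (1) the two height readings, decomposed by steps
  have hK1 : K + 1 - n = (K - n) + 1 := by omega
  have hP1 : D.PintH (K + 1) n V =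
      (∑ j ∈ Finset.range (K - n), levelDataT D PT (K + 1) (j + 1) n V) + levelDataT D PT (K + 1) 0 n V := by
    rw [PintH_eq_sum_levelDataT D PT hdec, hK1, Finset.sum_range_succ']
  have hP0 : D.PintH K n V = ∑ j ∈ Finset.range (K - n), levelDataT D PT K j n V := PintH_eq_sum_levelDataT D PT hdec K n V
  have hdiff : D.PintH (K + 1) n V - D.PintH K n V -
        ∑ j ∈ Finset.range (K - n), ∑ Y ∈ D.Loc K (K - n) (D.triv K (K - n)) (1 + j), c K n j Y =
      levelDataT D PT (K + 1) 0 n V +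
        ∑ j ∈ Finset.range (K - n), (levelDataT D PT (K + 1) (j + 1) n V - levelDataT D PT K j n V -
          ∑ Y ∈ D.Loc K (K - n) (D.triv K (K - n)) (1 + j), c K n j Y) := by
    rw [hP1, hP0, Finset.sum_sub_distrib, Finset.sum_sub_distrib]
    ring
  rw [hdiff]
  -- (2) the unmatched finest slice of run `K+1` (size IS a rate): (44) at run K+1, level 1; the count; then θ(n+1)² ≤ w n
  have hKn : K + 1 - n - 1 = K - n := by omega
  have hextra : |levelDataT D PT (K + 1) 0 n V| ≤ C' * C_T * N * (w n * La) := by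
    have hld : levelDataT D PT (K + 1) 0 n V = ∑ Y ∈ D.Loc (K + 1) (K + 1 - n) (D.triv (K + 1) (K + 1 - n)) 1,
        PT (K + 1) (K + 1 - n) 1 Y
          (fieldShift (F.sitesPerDir_eq (m := F.m) (K := K + 1) (j := K + 1 - n) (m' := F.m) (K' := n) (j' := 0) (by omega)) V) := by
      simp only [levelDataT, dif_pos hle, Nat.add_zero]
    rw [hld]
    have h1 : ∀ Y ∈ D.Loc (K + 1) (K + 1 - n) (D.triv (K + 1) (K + 1 - n)) 1,
        |PT (K + 1) (K + 1 - n) 1 Y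
            (fieldShift (F.sitesPerDir_eq (m := F.m) (K := K + 1) (j := K + 1 - n) (m' := F.m) (K' := n) (j' := 0) (by omega)) V)| ≤
          C_T * Real.exp (-κ₁ * D.treeLen (K + 1) 1 Y) * θBal F.L γ b₀ p₀ (n + 1) ^ 2 * (((F.L : ℝ) ^ (K - n))⁻¹) ^ 4 := by
      intro Y hY
      have h := hts (K + 1) n hle V hV 1 le_rfl (by omega) Y hY
      rw [hKn] at h
      exact h
    refine (Finset.abs_sum_le_sum_abs _ _).trans ((Finset.sum_le_sum h1).trans ?_)
    refine (extra_budget_le_count hCnt hCT ha1.le hn (D.triv (K + 1) (K + 1 - n))).trans ?_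
    rw [show 8 * C_T * C' * θBal F.L γ b₀ p₀ (n + 1) ^ 2 * (F.L : ℝ) ^ (3 * F.m) * (F.L : ℝ) ^ ((3 * n - a * (K - n : ℕ) : ℝ)) =
        C_T * C' * θBal F.L γ b₀ p₀ (n + 1) ^ 2 * (8 * (F.L : ℝ) ^ (3 * F.m) * (F.L : ℝ) ^ ((3 * n - a * (K - n : ℕ) : ℝ))) by ring,
      eight_pow_eq_card_mul F a K n]
    have hNL : 0 ≤ C_T * C' * (N * La) := by positivity
    calc C_T * C' * θBal F.L γ b₀ p₀ (n + 1) ^ 2 * ((Fintype.card (Site (F.P n) 0) : ℝ) * (((F.L : ℝ) ^ (K - n))⁻¹) ^ a)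
        = (C_T * C' * (N * La)) * θBal F.L γ b₀ p₀ (n + 1) ^ 2 := by ring
      _ ≤ (C_T * C' * (N * La)) * w n := mul_le_mul_of_nonneg_left (hw n) hNL
      _ = C' * C_T * N * (w n * La) := by ring
  -- (3) one matched level: the per-polymer slack row summed over the level's domains, margin kept
  have hlevel : ∀ j ∈ Finset.range (K - n),
      |levelDataT D PT (K + 1) (j + 1) n V - levelDataT D PT K j n V -
          ∑ Y ∈ D.Loc K (K - n) (D.triv K (K - n)) (1 + j), c K n j Y| ≤
        w n * (C * C' * N * La) * ra ^ (K - n - 1 - j) + θ ^ σ * (C * C' * N) * r0 ^ (K - n - 1 - j) := by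
    intro j hj
    rw [Finset.mem_range] at hj
    rw [levelDataT_succ_sub PT hLM hn hj V (c K n j)]
    refine (Finset.abs_sum_le_sum_abs _ _).trans ?_
    refine (Finset.sum_le_sum fun Y hY => hc K n hn j hj V hV Y hY).trans ?_
    -- split the summand into the rate piece (b = a) and the slack piece (b = 0)
    have hsplit : ∀ Y, C * Real.exp (-κ₁ * D.treeLen K (1 + j) Y) * (((F.L : ℝ) ^ (K - n - 1 - j))⁻¹) ^ 4 *
          (w n * (((F.L : ℝ) ^ (1 + j))⁻¹) ^ a + θBal F.L γ b₀ p₀ n ^ σ) =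
        w n * (C * Real.exp (-κ₁ * D.treeLen K (1 + j) Y) * (((F.L : ℝ) ^ (K - n - 1 - j))⁻¹) ^ 4 *
            (((F.L : ℝ) ^ (1 + j))⁻¹) ^ a) +
          θ ^ σ * (C * Real.exp (-κ₁ * D.treeLen K (1 + j) Y) * (((F.L : ℝ) ^ (K - n - 1 - j))⁻¹) ^ 4 *
            (((F.L : ℝ) ^ (1 + j))⁻¹) ^ (0 : ℝ)) := by
      intro Y
      rw [Real.rpow_zero]
      ring
    simp_rw [hsplit]
    rw [Finset.sum_add_distrib, ← Finset.mul_sum, ← Finset.mul_sum]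
    have hA := level_budget_geom_le_count (D := D) hCnt hC a hn (D.triv K (K - n)) hj
    have hB := level_budget_geom_le_count (D := D) hCnt hC (0 : ℝ) hn (D.triv K (K - n)) hj
    -- rewrite the two level budgets in the letters of the global row
    have hA' : 8 * C * C' * (F.L : ℝ) ^ (3 * F.m) * (F.L : ℝ) ^ ((3 * n - a * (K - n : ℕ) : ℝ)) *
          ((F.L : ℝ) ^ (a - 1)) ^ (K - n - 1 - j) = (C * C' * N * La) * ra ^ (K - n - 1 - j) := by
      rw [show 8 * C * C' * (F.L : ℝ) ^ (3 * F.m) * (F.L : ℝ) ^ ((3 * n - a * (K - n : ℕ) : ℝ)) =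
          C * C' * (8 * (F.L : ℝ) ^ (3 * F.m) * (F.L : ℝ) ^ ((3 * n - a * (K - n : ℕ) : ℝ))) by ring,
        eight_pow_eq_card_mul F a K n]
      ring
    have hB' : 8 * C * C' * (F.L : ℝ) ^ (3 * F.m) * (F.L : ℝ) ^ ((3 * n - (0 : ℝ) * (K - n : ℕ) : ℝ)) *
          ((F.L : ℝ) ^ ((0 : ℝ) - 1)) ^ (K - n - 1 - j) = (C * C' * N) * r0 ^ (K - n - 1 - j) := by
      rw [show 8 * C * C' * (F.L : ℝ) ^ (3 * F.m) * (F.L : ℝ) ^ ((3 * n - (0 : ℝ) * (K - n : ℕ) : ℝ)) =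
          C * C' * (8 * (F.L : ℝ) ^ (3 * F.m) * (F.L : ℝ) ^ ((3 * n - (0 : ℝ) * (K - n : ℕ) : ℝ))) by ring,
        eight_pow_eq_card_mul F 0 K n, Real.rpow_zero, zero_sub, Real.rpow_neg_one]
      ring
    rw [hA'] at hA
    rw [hB'] at hB
    refine (add_le_add (mul_le_mul_of_nonneg_left hA hwn) (mul_le_mul_of_nonneg_left hB hθσ)).trans_eq ?_
    ring
  -- (4) sum over the levels: geometric series in both pieces
  have hsumA : ∑ j ∈ Finset.range (K - n), ra ^ (K - n - 1 - j) ≤ 1 / (1 - ra) := sum_reflect_geom_le hra0 hra1 (K - n)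
  have hsum0 : ∑ j ∈ Finset.range (K - n), r0 ^ (K - n - 1 - j) ≤ 1 / (1 - r0) := sum_reflect_geom_le hr00 hr01 (K - n)
  have hmatched : |∑ j ∈ Finset.range (K - n), (levelDataT D PT (K + 1) (j + 1) n V - levelDataT D PT K j n V -
          ∑ Y ∈ D.Loc K (K - n) (D.triv K (K - n)) (1 + j), c K n j Y)| ≤
      w n * (C * C' * N * La) * (1 / (1 - ra)) + θ ^ σ * (C * C' * N) * (1 / (1 - r0)) := by
    refine (Finset.abs_sum_le_sum_abs _ _).trans ((Finset.sum_le_sum hlevel).trans ?_)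
    rw [Finset.sum_add_distrib, ← Finset.mul_sum, ← Finset.mul_sum]
    have hcA : 0 ≤ w n * (C * C' * N * La) := mul_nonneg hwn (by positivity)
    have hc0 : 0 ≤ θ ^ σ * (C * C' * N) := mul_nonneg hθσ (by positivity)
    exact add_le_add (mul_le_mul_of_nonneg_left hsumA hcA) (mul_le_mul_of_nonneg_left hsum0 hc0)
  -- (5) assemble
  refine (abs_add_le _ _).trans ((add_le_add hextra hmatched).trans ?_)
  have hkey : C' * C_T * N * (w n * La) + (w n * (C * C' * N * La) * (1 / (1 - ra)) +
        θ ^ σ * (C * C' * N) * (1 / (1 - r0))) =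
      C' * N * ((C_T + C / (1 - ra)) * (w n * La) + (C / (1 - r0)) * θ ^ σ) := by
    ring
  rw [hkey]
  have hT1 : C_T + C / (1 - ra) ≤ C_T + C / (1 - ra) + C / (1 - r0) := le_add_of_nonneg_right hT0
  have hT2 : C / (1 - r0) ≤ C_T + C / (1 - ra) + C / (1 - r0) := by linarith
  have hin : (C_T + C / (1 - ra)) * (w n * La) + (C / (1 - r0)) * θ ^ σ ≤
      (C_T + C / (1 - ra) + C / (1 - r0)) * (w n * La + θ ^ σ) := by
    rw [mul_add]
    exact add_le_add (mul_le_mul_of_nonneg_right hT1 (mul_nonneg hwn hLa0)) (mul_le_mul_of_nonneg_right hT2 hθσ)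
  calc C' * N * ((C_T + C / (1 - ra)) * (w n * La) + (C / (1 - r0)) * θ ^ σ)
      ≤ C' * N * ((C_T + C / (1 - ra) + C / (1 - r0)) * (w n * La + θ ^ σ)) :=
        mul_le_mul_of_nonneg_left hin (mul_nonneg hC' hN0)
    _ = _ := by ring

/-- **`GlobalSupRateTSlack` FROM THE PER-POLYMER SLACK ROW OVER THE LEVEL COUNT — THE VERBATIM 3⁗ LETTERS** (PROVED): the `w n := θ(n)²` instance; the
domination `θ(n+1)² ≤ θ(n)²` is the monotonicity of the thresholds (`T3Thresholds.θBal_succ_le`) on the window `√γ ≤ e^{1−p₀}`, `0 ≤ p₀`.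
[cite: King1986, Thm 3.4 (3.9) p.656 and (3.12)-(3.13) p.657; Balaban1985UV3, (43)-(46) pp.266-267] -/
theorem globalSupRateTSlack_of_polymerSlack_count {D : AlphaDataT3 F γ} {PT : TermFn F} {b₀ p₀ κ₁ a C C_T C' : ℝ} {σ : ℕ}
    (hγ : 0 < γ) (hγ1 : γ ≤ 1) (hγe : Real.sqrt γ ≤ Real.exp (1 - p₀)) (hb : 0 < b₀) (hp : 0 ≤ p₀)
    (ha : 0 < a) (ha1 : a < 1) (hC : 0 ≤ C) (hCT : 0 ≤ C_T)
    (hdec : PintDecompTrivT D PT) (hCnt : LocCount D κ₁ C') (hLM : LocMatched D)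
    (hTS : TermSizeTrivT D PT b₀ p₀ C_T κ₁) (hPC : PolymerCauchyMinAtTSlack D PT b₀ p₀ κ₁ a σ C) :
    GlobalSupRateTSlack D b₀ p₀ a σ (C' * (C_T + C / (1 - (F.L : ℝ) ^ (a - 1)) + C / (1 - (F.L : ℝ)⁻¹))) := by
  have hLn : 1 ≤ F.L := F.hL.2.le
  have hθ : ∀ i, 0 ≤ θBal F.L γ b₀ p₀ i := fun i => (T3MinimiserStabilityReduction.θBal_pos hLn hγ hγ1 hb p₀ i).le
  exact (globalSupRateTSlack_iff_W D b₀ p₀ a σ _).2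
    (globalSupRateWSlack_of_polymerWSlack_count (w := fun n => θBal F.L γ b₀ p₀ n ^ 2) hγ hγ1 hb (fun n => pow_nonneg (hθ n) 2)
      (fun n => pow_le_pow_left₀ (hθ (n + 1)) (θBal_succ_le hLn hγ hγ1 hγe hb.le hp n) 2) ha ha1 hC hCT hdec hCnt hLM hTS
      ((polymerCauchyMinAtTSlack_iff_W D PT b₀ p₀ κ₁ a σ C).1 hPC))

/-- **THE TAIL OF STUB 3⁗ FROM THE LOCAL ROWS OVER THE LEVEL COUNT** (PROVED): under the hypotheses of `globalSupRateTSlack_of_polymerSlack_count` and `7 ≤ σ`,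
`∃ σ₀ C₀, 7 ≤ σ₀ ∧ 0 ≤ C₀ ∧ GlobalSupRateTSlack D b₀ p₀ a σ₀ C₀` = the registered `stub_globalTwoRunSlackFam`'s conclusion after `∃ p … ∃ π`.
[cite: King1986, Thm 3.4 (3.9) p.656; Balaban1985UV3, (43)-(46) pp.266-267] -/
theorem globalTwoRunSlackTail_of_polymerSlack_count {D : AlphaDataT3 F γ} {PT : TermFn F} {b₀ p₀ κ₁ a C C_T C' : ℝ} {σ : ℕ}
    (hγ : 0 < γ) (hγ1 : γ ≤ 1) (hγe : Real.sqrt γ ≤ Real.exp (1 - p₀)) (hb : 0 < b₀) (hp : 0 ≤ p₀)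
    (ha : 0 < a) (ha1 : a < 1) (hC : 0 ≤ C) (hCT : 0 ≤ C_T) (hσ : 7 ≤ σ)
    (hdec : PintDecompTrivT D PT) (hCnt : LocCount D κ₁ C') (hLM : LocMatched D)
    (hTS : TermSizeTrivT D PT b₀ p₀ C_T κ₁) (hPC : PolymerCauchyMinAtTSlack D PT b₀ p₀ κ₁ a σ C) :
    ∃ (σ₀ : ℕ) (C₀ : ℝ), 7 ≤ σ₀ ∧ 0 ≤ C₀ ∧ GlobalSupRateTSlack D b₀ p₀ a σ₀ C₀ := by
  refine ⟨σ, _, hσ, ?_, globalSupRateTSlack_of_polymerSlack_count hγ hγ1 hγe hb hp ha ha1 hC hCT hdec hCnt hLM hTS hPC⟩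
  have hL : (1 : ℝ) < (F.L : ℝ) := by exact_mod_cast F.hL.2
  have hL0 : (0 : ℝ) < (F.L : ℝ) := by linarith
  have hra1 : (F.L : ℝ) ^ (a - 1) < 1 := Real.rpow_lt_one_of_one_lt_of_neg hL (by linarith)
  have hr01 : (F.L : ℝ)⁻¹ < 1 := inv_lt_one_of_one_lt₀ hL
  exact mul_nonneg hCnt.1 (add_nonneg (add_nonneg hCT (div_nonneg hC (by linarith))) (div_nonneg hC (by linarith)))

/-- **THE TAIL OF STUB 3⁗ FROM THE SIX LOCAL ROWS WITH THE `c`-WEIGHTED VOLUME** (PROVED): p530498's `globalTwoRunSlackTail_of_polymerSlack` with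
`LocBlockVolume D` weakened to `LocBlockVolumeC D c` — no condition ties the big-block size to the block size. [cite: King1986, Thm 3.4 (3.9) p.656; Balaban1985UV3, (24) p.262, (43)-(46) pp.266-267] -/
theorem globalTwoRunSlackTail_of_polymerSlack_volC {D : AlphaDataT3 F γ} {PT : TermFn F} {b₀ p₀ κ₁ a C C_T C' c : ℝ} {σ : ℕ}
    (hγ : 0 < γ) (hγ1 : γ ≤ 1) (hγe : Real.sqrt γ ≤ Real.exp (1 - p₀)) (hb : 0 < b₀) (hp : 0 ≤ p₀)
    (ha : 0 < a) (ha1 : a < 1) (hC : 0 ≤ C) (hCT : 0 ≤ C_T) (hσ : 7 ≤ σ)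
    (hdec : PintDecompTrivT D PT) (hLC : LocCover D κ₁ C') (hBV : LocBlockVolumeC D c) (hLM : LocMatched D)
    (hTS : TermSizeTrivT D PT b₀ p₀ C_T κ₁) (hPC : PolymerCauchyMinAtTSlack D PT b₀ p₀ κ₁ a σ C) :
    ∃ (σ₀ : ℕ) (C₀ : ℝ), 7 ≤ σ₀ ∧ 0 ≤ C₀ ∧ GlobalSupRateTSlack D b₀ p₀ a σ₀ C₀ :=
  globalTwoRunSlackTail_of_polymerSlack_count hγ hγ1 hγe hb hp ha ha1 hC hCT hσ hdec (locCount_of_cover_of_volumeC hLC hBV) hLM hTS hPC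

/-- The landed producer (p530498) is the `c = 1` case of the `c`-weighted one — nothing proved for `LocBlockVolume` is lost. [cite: Balaban1985UV3, (24) p.262] -/
theorem globalTwoRunSlackTail_of_polymerSlack_vol {D : AlphaDataT3 F γ} {PT : TermFn F} {b₀ p₀ κ₁ a C C_T C' : ℝ} {σ : ℕ}
    (hγ : 0 < γ) (hγ1 : γ ≤ 1) (hγe : Real.sqrt γ ≤ Real.exp (1 - p₀)) (hb : 0 < b₀) (hp : 0 ≤ p₀)
    (ha : 0 < a) (ha1 : a < 1) (hC : 0 ≤ C) (hCT : 0 ≤ C_T) (hσ : 7 ≤ σ)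
    (hdec : PintDecompTrivT D PT) (hLC : LocCover D κ₁ C') (hBV : LocBlockVolume D) (hLM : LocMatched D)
    (hTS : TermSizeTrivT D PT b₀ p₀ C_T κ₁) (hPC : PolymerCauchyMinAtTSlack D PT b₀ p₀ κ₁ a σ C) :
    ∃ (σ₀ : ℕ) (C₀ : ℝ), 7 ≤ σ₀ ∧ 0 ≤ C₀ ∧ GlobalSupRateTSlack D b₀ p₀ a σ₀ C₀ :=
  globalTwoRunSlackTail_of_polymerSlack_volC hγ hγ1 hγe hb hp ha ha1 hC hCT hσ hdec hLC (locBlockVolumeC_one_of_volume hBV) hLM hTS hPC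

end Summit.QuantumFields.YangMills.Theorems.GlobalSlackLocalToGlobalCount

end
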